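import Literature.MathematicalPhysics.KineticTheory.VelocityAveragingReduction
import Literature.Analysis.FunctionSpaces.KolmogorovRiesz
import HarnessLib

/-!
# Discharged fact: `L¹` compactness of velocity averages (CIP 1994 Lemma 5.3.9)

Topic: MathematicalPhysics / KineticTheory. `VelocityAveraging` states the velocity-averaging
lemma of DiPerna–Lions in the form of Cercignani–Illner–Pulvirenti 1994, Lemma 5.3.9 (p. 154) as
the named fact `velocityAverage_relativelyCompact_L1`; this file proves it
(`velocityAverage_relativelyCompact_L1_holds`), completing the Fourier-free (`TT*`) route of
`FreeTransportDuhamel`, `FreeTransportUniqueness`, `VelocityAverageOperator`,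
`VelocityAverageKernel`, `VelocityAverageCompact`, `VelocityAveragingLocalization`,
`VelocityAveragingReduction` (kinetic side) and `Literature.Analysis.FunctionSpaces.KolmogorovRiesz`,
`Literature.Analysis.FunctionSpaces.UnifIntegrableEgorov` (functional-analytic side).

Proof (CIP pp. 154–155 with the `H^{1/2}`/Rellich step replaced by `TT*` + Kolmogorov–Riesz): for
`T ≤ 0` the slab is empty. For `0 < T`, by `exists_avgDuhamel_near` the velocity averages
`ρₙ = ∫ gₙ ψₙ dξ` are, for `n ≥ N(ε)`, `ε`-close in `L¹((0,T) × E)` to averaged Duhamel integrals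
`A Fₙ` of `L^∞`-bounded sources with common compact support; these are equicontinuous under
translation in `L²` (`avgDuhamel_translate_modulus`), compactly supported and bounded, hence
totally bounded in `L²(ℝ × E)` by the Kolmogorov–Riesz criterion
(`Literature.Analysis.FunctionSpaces.exists_finset_eLpNorm_sub_lt_of_translate`), hence in `L¹((0,T) × E)`; so `{ρₙ}` is
totally bounded in the complete space `L¹((0,T) × E)`, its closure is compact, and every
subsequence has an `L¹`-convergent subsequence (`IsCompact.tendsto_subseq`).

## References

* C. Cercignani, R. Illner, M. Pulvirenti, *The Mathematical Theory of Dilute Gases*, Springer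
  (1994), §5.3, Lemma 5.3.9, p. 154, and its proof, pp. 154–155. [CIPDiluteGases1994]
* R. J. DiPerna, P.-L. Lions, *On the Cauchy problem for Boltzmann equations: global existence and
  weak stability*, Ann. of Math. 130 (1989) 321–366, §II. [DiPernaLionsAnnals1989]
-/

noncomputable section

open MeasureTheory Set Filter Function Metric
open _root_.Topology
open scoped ENNReal NNReal

namespace Literature.MathematicalPhysics.KineticTheory

variable {E : Type*} [NormedAddCommGroup E] [InnerProductSpace ℝ E] [FiniteDimensional ℝ E]
  [MeasurableSpace E] [BorelSpace E]

/-! ## From `L²(ℝ × E)` to `L¹` on the base slab -/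

section L2L1

/-- `‖f‖_{L¹} ≤ |K|^{1/2} ‖f‖_{L²}` for `f` vanishing off `K`, in real form:
`∫ |f| ≤ (|K|^{1/2} ‖f‖_{L²(volume)}).toReal` for the base slab measure (dominated by Lebesgue
measure). [folklore] -/
theorem integral_abs_le_of_eLpNorm_two {T : ℝ} {f : ℝ × E → ℝ} (hfm : AEStronglyMeasurable f volume)
    {K : Set (ℝ × E)} (hKf : volume K < ⊤) (hf0 : ∀ p, p ∉ K → f p = 0)
    (hf2 : eLpNorm f 2 volume < ⊤) :
    ∫ p, |f p| ∂baseSlabMeasure E T ≤ (volume K ^ (1 / 2 : ℝ) * eLpNorm f 2 volume).toReal := by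
  have hsupp : Function.support f ⊆ K := fun p hp => by_contra fun h => hp (hf0 p h)
  -- `f ∈ L¹(volume)` with the Hölder bound
  have h1 : eLpNorm f 1 volume ≤ volume K ^ (1 / 2 : ℝ) * eLpNorm f 2 volume := by
    rw [← eLpNorm_restrict_eq_of_support_subset hsupp]
    haveI : IsFiniteMeasure (volume.restrict K) := ⟨by rwa [Measure.restrict_apply_univ]⟩
    have h := eLpNorm_le_eLpNorm_mul_rpow_measure_univ (p := 1) (q := 2) (by norm_num)
      (hfm.restrict (s := K)) (μ := volume.restrict K)
    rw [Measure.restrict_apply_univ] at h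
    have hexp : (1 / (1 : ℝ≥0∞).toReal - 1 / (2 : ℝ≥0∞).toReal : ℝ) = 1 / 2 := by norm_num
    rw [hexp] at h
    refine h.trans ?_
    rw [mul_comm]
    gcongr
    exact Measure.restrict_le_self
  have hfi : Integrable f volume := by
    refine ⟨hfm, ?_⟩
    unfold HasFiniteIntegral
    rw [← eLpNorm_one_eq_lintegral_enorm]
    exact h1.trans_lt (ENNReal.mul_lt_top (ENNReal.rpow_lt_top_of_nonneg (by norm_num) hKf.ne) hf2)
  calc ∫ p, |f p| ∂baseSlabMeasure E T ≤ ∫ p, |f p| ∂volume := by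
        rw [baseSlabMeasure_def]
        exact integral_mono_measure Measure.restrict_le_self (ae_of_all _ fun p => abs_nonneg _) hfi.abs
    _ = (eLpNorm f 1 volume).toReal := by
        rw [eLpNorm_one_eq_lintegral_enorm, ← integral_norm_eq_lintegral_enorm hfm]
        simp only [Real.norm_eq_abs]
    _ ≤ (volume K ^ (1 / 2 : ℝ) * eLpNorm f 2 volume).toReal :=
        ENNReal.toReal_mono (ENNReal.mul_ne_top (ENNReal.rpow_ne_top_of_nonneg (by norm_num) hKf.ne) hf2.ne) h1

end L2L1

/-! ## The discharge -/

section Discharge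

/-- `‖f - g‖_{L¹(ν)} < ε` in `ℝ≥0∞` from the real inequality, for integrable `f, g`. [folklore] -/
theorem eLpNorm_sub_lt_of_integral_abs_lt {X : Type*} [MeasurableSpace X] {μ : Measure X}
    {f g : X → ℝ} (hf : Integrable f μ) (hg : Integrable g μ) {ε : ℝ≥0∞}
    (hε : ε ≠ ⊤) (h : ∫ x, |f x - g x| ∂μ < ε.toReal) : eLpNorm (f - g) 1 μ < ε := by
  have e : eLpNorm (f - g) 1 μ = ENNReal.ofReal (∫ x, |f x - g x| ∂μ) := by
    rw [eLpNorm_one_eq_lintegral_enorm, ← ofReal_integral_norm_eq_lintegral_enorm (hf.sub hg)]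
    simp only [Pi.sub_apply, Real.norm_eq_abs]
  rw [e, ← ENNReal.ofReal_toReal hε]
  exact (ENNReal.ofReal_lt_ofReal_iff (lt_of_le_of_lt (integral_nonneg fun x => abs_nonneg _) h)).2 h

/-- **Discharge of `velocityAverage_relativelyCompact_L1`** (Cercignani–Illner–Pulvirenti 1994,
Lemma 5.3.9, p. 154; DiPerna–Lions 1989, §II): under the hypotheses of the named fact — `(gₙ)`
uniformly integrable and uniformly tight in `L¹((0,T) × E × E)`, `T gₙ = hₙ` in `𝒟'((0,T) × E × E)`
with `(hₙ)` uniformly integrable on compact subsets of the open slab, `(ψₙ)` bounded in `L^∞` and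
a.e. convergent — every subsequence of the velocity averages `∫ gₙ ψₙ dξ` has a further subsequence
converging in `L¹((0,T) × E)`. Proof as in CIP pp. 154–155 (reductions: `exists_avgDuhamel_near`)
except that the compactness of the averaged solutions of `T u = F`, `F ∈ L^∞` with common compact
support, is obtained from the `TT*` equicontinuity estimate `avgDuhamel_translate_modulus` and the
Kolmogorov–Riesz criterion (`Literature.Analysis.FunctionSpaces.exists_finset_eLpNorm_sub_lt_of_translate`) instead of the
`H^{1/2}` bound of Lemma 5.3.8 and Rellich's theorem; total boundedness in the complete space
`L¹((0,T) × E)` then gives the convergent subsequence (`IsCompact.tendsto_subseq`). [cite: CIPDiluteGases1994, §5.3 Lemma 5.3.9 (p. 154)] -/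
theorem velocityAverage_relativelyCompact_L1_holds : velocityAverage_relativelyCompact_L1 := by
  intro E _ _ _ _ _ T g h ψ ψlim hUI hUT hTr hh hψm hψM hψlim φ hφ
  ---- the degenerate slab
  by_cases hT : T ≤ 0
  · have hslab : Ioo (0 : ℝ) T = ∅ := Ioo_eq_empty (not_lt.2 hT)
    have hν : baseSlabMeasure E T = 0 := by
      rw [baseSlabMeasure_def, hslab, Set.empty_prod, Measure.restrict_empty]
    refine ⟨id, strictMono_id, fun _ => 0, ?_, ?_⟩
    · rw [hν]; exact integrable_zero_measure
    · simp only [hν, integral_zero_measure]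
      exact tendsto_const_nhds
  push Not at hT
  ---- notation and integrability of the velocity averages
  set ν : Measure (ℝ × E) := baseSlabMeasure E T with hν_def
  set ρ : ℕ → ℝ × E → ℝ := fun n => velocityIntegral (ψ n) (g n) with hρ_def
  have hgi : ∀ n, Integrable (g n) (slabMeasure E T) := integrable_of_uniformIntegrable hUI
  obtain ⟨M, hM⟩ := hψM
  have hρi : ∀ n, Integrable (ρ n) ν := fun n => integrable_velocityIntegral (hgi n) (hψm n) (hM n)
  have hρ1 : ∀ n, MemLp (ρ n) 1 ν := fun n => memLp_one_iff_integrable.2 (hρi n)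
  ---- total boundedness in `L¹(ν)`: finite `ε`-nets among the `ρₙ`
  have hnet : ∀ ε : ℝ, 0 < ε → ∃ s : Finset ℕ, ∀ n, ∃ m ∈ s, ∫ p, |ρ n p - ρ m p| ∂ν < ε := by
    intro ε hε
    have hε4 : 0 < ε / 4 := by positivity
    obtain ⟨N, B, R, hR0, F, hFm, hFb, hFR, hnear⟩ :=
      exists_avgDuhamel_near hT hUI hUT hTr hh hψm ⟨M, hM⟩ hψlim hε4
    -- the weight `𝟙_{B̄(0,R)}`
    set ψ₀ : E → ℝ := (closedBall (0 : E) R).indicator fun _ => (1 : ℝ) with hψ₀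
    have hψ₀m : Measurable ψ₀ := measurable_const.indicator measurableSet_closedBall
    have hψ₀b : ∀ ξ, |ψ₀ ξ| ≤ 1 := fun ξ => by
      rw [hψ₀]; by_cases hξ : ξ ∈ closedBall (0 : E) R <;> simp [hξ]
    have hψ₀r : ∀ ξ, R < ‖ξ‖ → ψ₀ ξ = 0 := fun ξ hξ => by
      rw [hψ₀]; exact indicator_of_notMem (by rw [mem_closedBall_zero_iff, not_le]; exact hξ) _
    have hψ₀i : Integrable ψ₀ volume :=
      integrable_of_bounded_of_eq_zero hψ₀m.aestronglyMeasurable hψ₀b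
        (isCompact_closedBall (0 : E) R).measure_lt_top (fun ξ hξ => by
          rw [hψ₀]; exact indicator_of_notMem hξ _)
    -- the family of averaged Duhamel integrals, indexed by `n ≥ N`
    set w : {n : ℕ // N ≤ n} → ℝ × E → ℝ := fun i => avgDuhamel ψ₀ T (F i) with hw_def
    set K : Set (ℝ × E) := closedBall (0 : ℝ × E) (R + T + T * R) with hK_def
    have hKc : IsCompact K := isCompact_closedBall _ _
    have hKm : MeasurableSet K := measurableSet_closedBall
    have hKvol : volume K < ⊤ := hKc.measure_lt_top
    have hwm : ∀ i, AEStronglyMeasurable (w i) volume := fun i =>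
      (stronglyMeasurable_avgDuhamel hψ₀m (hFm i)).aestronglyMeasurable
    have hwK : ∀ i p, p ∉ K → w i p = 0 := fun i p hp =>
      avgDuhamel_eq_zero_of_norm_gt hR0 (hFR i) hT.le (by rwa [hK_def, mem_closedBall_zero_iff, not_le] at hp)
    set Cw : ℝ := (∫ ξ, |ψ₀ ξ|) * (T * B) with hCw
    have hwb : ∀ i p, ‖w i p‖ ≤ Cw := fun i p => (Real.norm_eq_abs _).le.trans
      (abs_avgDuhamel_le hψ₀i hT.le (hFb i) p)
    set A : ℝ≥0∞ := volume K ^ (2 : ℝ≥0∞).toReal⁻¹ * ENNReal.ofReal Cw with hA_def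
    have hAt : A ≠ ⊤ := ENNReal.mul_ne_top (ENNReal.rpow_ne_top_of_nonneg (by positivity) hKvol.ne)
      ENNReal.ofReal_ne_top
    have hwA : ∀ i, eLpNorm (w i) 2 volume ≤ A := fun i =>
      Literature.Analysis.FunctionSpaces.eLpNorm_le_of_forall_norm_le_of_support_subset volume
        (hwK i) (hwb i) 2
    have hmod : ∀ ε' : ℝ≥0∞, 0 < ε' → ∃ δ : ℝ, 0 < δ ∧
        ∀ i, ∀ y : ℝ × E, ‖y‖ ≤ δ → eLpNorm (fun x => w i (x - y) - w i x) 2 volume ≤ ε' := by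
      intro ε' hε'
      by_cases hε't : ε' = ⊤
      · exact ⟨1, one_pos, fun i y _ => by rw [hε't]; exact le_top⟩
      have hε'r : 0 < ε'.toReal := ENNReal.toReal_pos hε'.ne' hε't
      obtain ⟨δ, hδ, hδw⟩ := avgDuhamel_translate_modulus hψ₀m hψ₀b hR0 hψ₀r hT.le B hR0 hε'r
      refine ⟨δ, hδ, fun i y hy => ?_⟩
      rw [← ENNReal.ofReal_toReal hε't]
      exact hδw (F i) (hFm i) (hFb i) (hFR i) y hy
    -- Kolmogorov–Riesz
    set VK : ℝ := (volume K ^ (1 / 2 : ℝ)).toReal with hVK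
    have hVK0 : 0 ≤ VK := ENNReal.toReal_nonneg
    set η : ℝ≥0∞ := ENNReal.ofReal (ε / 4 / (VK + 1)) with hη_def
    have hη : 0 < η := ENNReal.ofReal_pos.2 (by positivity)
    haveI : (volume : Measure (ℝ × E)).IsAddHaarMeasure := Measure.prod.instIsAddHaarMeasure _ _
    obtain ⟨sKR, hsKR⟩ :=
      Literature.Analysis.FunctionSpaces.exists_finset_eLpNorm_sub_lt_of_translate volume one_le_two
        ENNReal.ofNat_ne_top hKc w hwm hwK hAt hwA hmod hη
    -- integrability of the `w i` on the base slab
    have hwi : ∀ i, Integrable (w i) ν := fun i => by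
      have h := integrable_of_bounded_of_eq_zero (hwm i) (C := Cw)
        (fun p => (Real.norm_eq_abs _).symm.le.trans (hwb i p)) hKvol (hwK i)
      rw [hν_def, baseSlabMeasure_def]; exact h.mono_measure Measure.restrict_le_self
    -- triangle inequality on the base slab
    have tri : ∀ {a b c : ℝ × E → ℝ}, Integrable a ν → Integrable b ν → Integrable c ν →
        ∫ p, |a p - c p| ∂ν ≤ (∫ p, |a p - b p| ∂ν) + ∫ p, |b p - c p| ∂ν := by
      intro a b c ha hb hc
      have h1 : Integrable (fun p => |a p - b p|) ν := (ha.sub hb).abs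
      have h2 : Integrable (fun p => |b p - c p|) ν := (hb.sub hc).abs
      rw [← integral_add h1 h2]
      exact integral_mono_of_nonneg (ae_of_all _ fun p => abs_nonneg _) (h1.add h2)
        (ae_of_all _ fun p => abs_sub_le _ _ _)
    -- `L²`-closeness of two members gives `L¹(ν)`-closeness
    have hL2 : ∀ i i' : {n : ℕ // N ≤ n}, eLpNorm (w i - w i') 2 volume < η →
        ∫ p, |w i p - w i' p| ∂ν ≤ ε / 4 := by
      intro i i' hd
      have h := integral_abs_le_of_eLpNorm_two (T := T) ((hwm i).sub (hwm i')) hKvol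
        (fun p hp => by simp only [Pi.sub_apply]; rw [hwK i p hp, hwK i' p hp, sub_zero])
        (hd.trans ENNReal.ofReal_lt_top)
      refine h.trans ?_
      have hne : volume K ^ (1 / 2 : ℝ) ≠ ⊤ := ENNReal.rpow_ne_top_of_nonneg (by norm_num) hKvol.ne
      calc (volume K ^ (1 / 2 : ℝ) * eLpNorm (w i - w i') 2 volume).toReal
          ≤ (volume K ^ (1 / 2 : ℝ) * η).toReal :=
            ENNReal.toReal_mono (ENNReal.mul_ne_top hne ENNReal.ofReal_ne_top) (mul_le_mul' le_rfl hd.le)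
        _ = VK * (ε / 4 / (VK + 1)) := by
            rw [ENNReal.toReal_mul, hη_def, ENNReal.toReal_ofReal (by positivity)]
        _ ≤ ε / 4 := by
            rw [mul_div_assoc', div_le_iff₀ (by positivity)]
            nlinarith
    classical
    refine ⟨sKR.image Subtype.val ∪ Finset.range N, fun n => ?_⟩
    by_cases hn : N ≤ n
    · obtain ⟨jj, hjj, hdist⟩ := hsKR ⟨n, hn⟩
      refine ⟨jj.val, Finset.mem_union_left _ (Finset.mem_image_of_mem _ hjj), ?_⟩
      have h1 : ∫ p, |ρ n p - w ⟨n, hn⟩ p| ∂ν ≤ ε / 4 := hnear n hn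
      have h2 : ∫ p, |w ⟨n, hn⟩ p - w jj p| ∂ν ≤ ε / 4 := hL2 _ _ hdist
      have h3 : ∫ p, |w jj p - ρ jj.val p| ∂ν ≤ ε / 4 := by
        have := hnear jj.val jj.2
        refine le_trans (le_of_eq (integral_congr_ae (ae_of_all _ fun p => ?_))) this
        exact abs_sub_comm _ _
      calc ∫ p, |ρ n p - ρ jj.val p| ∂ν
          ≤ (∫ p, |ρ n p - w ⟨n, hn⟩ p| ∂ν) + ∫ p, |w ⟨n, hn⟩ p - ρ jj.val p| ∂ν :=
            tri (hρi n) (hwi _) (hρi _)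
        _ ≤ ε / 4 + (ε / 4 + ε / 4) := by
            gcongr
            exact (tri (hwi _) (hwi jj) (hρi _)).trans (add_le_add h2 h3)
        _ < ε := by linarith
    · refine ⟨n, Finset.mem_union_right _ (Finset.mem_range.2 (not_le.1 hn)), ?_⟩
      simp only [sub_self, abs_zero, integral_zero]
      exact hε
  ---- compactness in `L¹(ν)` and extraction of the subsequence
  let Φ : ℕ → Lp ℝ 1 ν := fun n => (hρ1 n).toLp (ρ n)
  have htb : TotallyBounded (range Φ) := by
    refine EMetric.totallyBounded_iff.2 fun ε hε => ?_
    have hε' : 0 < (if ε = ⊤ then (1 : ℝ) else ε.toReal) := by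
      split_ifs with h
      · exact one_pos
      · exact ENNReal.toReal_pos hε.ne' h
    obtain ⟨s, hs⟩ := hnet _ hε'
    refine ⟨Φ '' s, s.finite_toSet.image Φ, ?_⟩
    rintro _ ⟨n, rfl⟩
    obtain ⟨m, hm, hnm⟩ := hs n
    refine mem_iUnion₂.2 ⟨Φ m, mem_image_of_mem Φ hm, ?_⟩
    rw [Metric.mem_eball, Lp.edist_toLp_toLp]
    by_cases hεt : ε = ⊤
    · rw [hεt]
      exact (memLp_one_iff_integrable.2 ((hρi n).sub (hρi m))).eLpNorm_lt_top
    · rw [if_neg hεt] at hnm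
      exact eLpNorm_sub_lt_of_integral_abs_lt (hρi n) (hρi m) hεt hnm
  have hcomp : IsCompact (closure (range Φ)) :=
    htb.closure.isCompact_of_isClosed isClosed_closure
  obtain ⟨G, -, φ', hφ', hlim⟩ :=
    hcomp.tendsto_subseq (x := Φ ∘ φ) fun k => subset_closure (mem_range_self (φ k))
  refine ⟨φ', hφ', ⇑G, L1.integrable_coeFn G, ?_⟩
  rw [tendsto_iff_edist_tendsto_0] at hlim
  have hlim' : Tendsto (fun k => eLpNorm (ρ (φ (φ' k)) - ⇑G) 1 ν) atTop (𝓝 0) := by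
    refine hlim.congr fun k => ?_
    simp only [Function.comp_apply]
    rw [Lp.edist_def]
    exact eLpNorm_congr_ae ((hρ1 _).coeFn_toLp.sub EventuallyEq.rfl)
  have hfin := (ENNReal.tendsto_toReal ENNReal.zero_ne_top).comp hlim'
  rw [ENNReal.toReal_zero] at hfin
  refine hfin.congr fun k => ?_
  simp only [Function.comp_apply]
  rw [eLpNorm_one_eq_lintegral_enorm,
    ← integral_norm_eq_lintegral_enorm ((hρi _).sub (L1.integrable_coeFn G)).aestronglyMeasurable]
  simp only [Pi.sub_apply, Real.norm_eq_abs, hρ_def]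

end Discharge

end Literature.MathematicalPhysics.KineticTheory
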